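/-
Copyright (c) 2026. All rights reserved.
Released under Apache 2.0 license as described in the file LICENSE.
Authors: abc-iut cell — seat abc-iut-w6-d024 (gen 4; block C / W6, L4-lead RULING #7o row «COR27e-TYPE»):
PROOF-ONLY toolkit for the companion of `ArchimedeanReconstructionCor27eGermAutFromAutHol.lean` (p437330).
-/
import Literature.AnabelianGeometry.AbsoluteAnabelian.ArchimedeanReconstructionTangentFramesProofs
import HarnessLib

/-!
# [AbsTopIII] Cor 2.7 (d)/(e) on a planar Aut-holomorphic disc: prescribed orbit velocities, order-four
# stabiliser elements, conjugate velocities — PROOFS (no definitions)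

S. Mochizuki, *Topics in absolute anabelian geometry III* (bib key `MochizukiAbsTopIII2015`), Cor 2.7 (d)
(kurims p.59 l.27–45) and (e) (p.60 l.2–14).  For a planar Aut-holomorphic disc `V ⊆ ℂ`
(`IsAutHolDisc ↥V`; the chart picture of a parallelogram `V^top ⊆ E^top`) and `p ∈ V`, in the typed
language of one-parameter subgroups (continuous `f : ℝ → Aut^hol(V) = holAut ⊤`, compact-open topology,
abc-iut-L4-t7 / abc-iut-w4-d104):

* `exists_chart_upperHalfPlane_centered` — a biholomorphic `κ : V ⥲ ℍ` with `κ p = i`;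
* `exists_oneParameterSubgroup_hasDerivAt` — EVERY vector `w` at `p` is the velocity of the orbit
  `t ↦ f(t) · p` of a continuous one-parameter subgroup (image under Prop 2.2 (ii)
  `SL₂(ℝ)/{±1} ⥲ Aut^hol(V)`, `exists_continuousMulEquiv_sl`, of `t ↦ exp(tX)` for an explicit traceless `X`);
* `exists_orderFour_stabilizer` — the stabiliser of `p` contains an element `k` with `k⁴ = 1 ≠ k²`
  ("an element of order four [i.e., '`±i`']": the image of the rotation `R(π/4)`);
* `deriv_conj_orbit_eq` — conjugating `f` by such a `k` multiplies the orbit velocity at `p` by the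
  derivative `±i` of the planar picture of `k` (abc-iut-w4-d104's `stab_deriv_eq_I_or_of_order_four`),
  and `deriv_planar_inv_mul_deriv_planar` — the planar derivatives of `k`, `k⁻¹` at `p` multiply to `1`.

Used by `ArchimedeanReconstructionCor27eGermAutFromAutHolProofs.lean` (the frames of (d) are exactly the
pairs of non-zero orthogonal vectors, whence Cor 2.7 (e) at the germ model).  MODEL LEVEL; refereed
pre-IUT material; nothing here bears on the disputed [IUTchIII] Cor. 3.12; typed ≠ endorsed.
-/

noncomputable section

namespace Literature.AnabelianGeometry.AbsoluteAnabelian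

open _root_.TopologicalSpace _root_.Topology _root_.Set _root_.Metric _root_.Function _root_.Filter
open scoped _root_.Manifold _root_.ContDiff ComplexConjugate UpperHalfPlane MatrixGroups InnerProductSpace
open _root_.UpperHalfPlane Literature.Analysis.Complex NormedSpace _root_.Complex
open scoped Matrix.Norms.Operator

set_option backward.isDefEq.respectTransparency false

namespace Cor27e

variable (V : Opens ℂ)

/-! ### A biholomorphic chart `V ⥲ ℍ` sending `p` to `i` -/

/-- For a planar Aut-holomorphic disc `V` and `p ∈ V` there is a biholomorphic `κ : V ⥲ ℍ` with
`κ p = i` (disc structure, Cayley transform, then a Möbius transformation of `ℍ`).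
[cite: MochizukiAbsTopIII2015, Corollary 2.7 (d) p.59] -/
theorem exists_chart_upperHalfPlane_centered (hV : IsAutHolDisc V) (p : V) :
    ∃ κ : (⊤ : Opens V) ≃ₜ ℍ, MDifferentiable 𝓘(ℂ, ℂ) 𝓘(ℂ, ℂ) κ ∧
      MDifferentiable 𝓘(ℂ, ℂ) 𝓘(ℂ, ℂ) κ.symm ∧ κ ⟨p, trivial⟩ = UpperHalfPlane.I := by
  -- the disc structure of `V`, read on `⊤ ⊆ V`, followed by the Cayley transform (as in abc-iut-w4-d104's
  -- `exists_conj_expHom_of_continuous`)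
  obtain ⟨e, he, hes⟩ := hV.exists_biholomorphic
  let tY : (⊤ : Opens V) ≃ₜ V :=
    { toFun := Subtype.val
      invFun := fun x => ⟨x, trivial⟩
      left_inv := fun _ => rfl
      right_inv := fun _ => rfl
      continuous_toFun := continuous_subtype_val
      continuous_invFun := continuous_id.subtype_mk _ }
  have htY : MDifferentiable 𝓘(ℂ, ℂ) 𝓘(ℂ, ℂ) tY := fun y =>
    (mdifferentiableAt_opens_dom_iff (U := (⊤ : Opens V)) (Φ := id)
      (Ψ := fun y : (⊤ : Opens V) => (y : V)) (fun _ => rfl) y).2 mdifferentiableAt_id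
  have htYs : MDifferentiable 𝓘(ℂ, ℂ) 𝓘(ℂ, ℂ) tY.symm := fun x =>
    (mdifferentiableAt_opens_cod_iff (V := (⊤ : Opens V))
      (Ψ := fun x : V => (⟨x, trivial⟩ : (⊤ : Opens V))) x).2 mdifferentiableAt_id
  obtain ⟨C, hC, hCs, -, -⟩ := exists_cayley
  set κ₀ : (⊤ : Opens V) ≃ₜ ℍ := (tY.trans e).trans C with hκ₀def
  have hκ₀ : MDifferentiable 𝓘(ℂ, ℂ) 𝓘(ℂ, ℂ) κ₀ := hC.comp (he.comp htY)
  have hκ₀s : MDifferentiable 𝓘(ℂ, ℂ) 𝓘(ℂ, ℂ) κ₀.symm := htYs.comp (hes.comp hCs)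
  -- move `τ := κ₀ p` to `i` by the Möbius transformation `z ↦ (z - Re τ) / Im τ`
  set τ : ℍ := κ₀ ⟨p, trivial⟩ with hτdef
  set u : ℝ := (τ : ℂ).re with hu
  set v : ℝ := (τ : ℂ).im with hv
  have hv0 : 0 < v := τ.im_pos
  set s : ℝ := Real.sqrt v with hsdef
  have hs0 : 0 < s := Real.sqrt_pos.2 hv0
  have hss : s * s = v := Real.mul_self_sqrt hv0.le
  let g : SL(2, ℝ) := ⟨!![s⁻¹, -u * s⁻¹; 0, s], by
    rw [Matrix.det_fin_two_of]; field_simp; ring⟩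
  refine ⟨κ₀.trans (Homeomorph.smul g), (mdifferentiable_sl_smul g).comp hκ₀, ?_, ?_⟩
  · have h : ⇑(κ₀.trans (Homeomorph.smul g)).symm = κ₀.symm ∘ fun z : ℍ => g⁻¹ • z := by
      funext z; rfl
    rw [h]
    exact hκ₀s.comp (mdifferentiable_sl_smul g⁻¹)
  · show g • τ = UpperHalfPlane.I
    apply UpperHalfPlane.ext
    rw [coe_sl_smul, UpperHalfPlane.coe_I]
    have h00 : (g 0 0 : ℝ) = s⁻¹ := rfl
    have h01 : (g 0 1 : ℝ) = -u * s⁻¹ := rfl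
    have h10 : (g 1 0 : ℝ) = 0 := rfl
    have h11 : (g 1 1 : ℝ) = s := rfl
    rw [h00, h01, h10, h11]
    have hτ : (τ : ℂ) = (u : ℂ) + (v : ℂ) * Complex.I := by
      rw [hu, hv]; exact (Complex.re_add_im _).symm
    have hs0' : (s : ℂ) ≠ 0 := by exact_mod_cast hs0.ne'
    rw [div_eq_iff (by rw [Complex.ofReal_zero, zero_mul, zero_add]; exact hs0'), hτ, ← hss]
    push_cast
    field_simp
    ring


/-! ### One-parameter subgroups with prescribed orbit velocity -/

/-- **Every vector at `p` is the velocity of the orbit of a one-parameter subgroup**: for `w ∈ ℂ` there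
is a continuous one-parameter subgroup `f : ℝ → Aut^hol(V)` (compact-open topology) whose orbit
`t ↦ f(t) · p` has velocity `w` at `t = 0` (the image under Prop 2.2 (ii) `SL₂(ℝ)/{±1} ⥲ Aut^hol(V)`
of `t ↦ exp (tX)` for an explicit traceless `X`). [cite: MochizukiAbsTopIII2015, Corollary 2.7 (d) p.59] -/
theorem exists_oneParameterSubgroup_hasDerivAt (hV : IsAutHolDisc V) (p : V) (w : ℂ) :
    letI := homeoCompactOpen (⊤ : Opens V)
    ∃ f : Multiplicative ℝ →* holAut (⊤ : Opens V), Continuous f ∧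
      HasDerivAt (fun t : ℝ =>
        (((((f (Multiplicative.ofAdd t) : holAut (⊤ : Opens V)) : (⊤ : Opens V) ≃ₜ (⊤ : Opens V))
          ⟨p, trivial⟩ : (⊤ : Opens V)) : V) : ℂ)) w 0 := by
  letI := homeoCompactOpen (⊤ : Opens V)
  obtain ⟨κ, hκ, hκs, hκp⟩ := exists_chart_upperHalfPlane_centered V hV p
  obtain ⟨F, hF⟩ := exists_continuousMulEquiv_sl κ hκ hκs (holAut (⊤ : Opens V)) fun ψ => mem_holAut_iff ψ
  -- the coordinate of `κ⁻¹`, and its (non-zero) derivative at `i`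
  set G : ℂ → ℂ := fun w : ℂ => (((κ.symm (ofComplex w) : (⊤ : Opens V)) : V) : ℂ) with hG
  set d : ℂ := deriv G ((UpperHalfPlane.I : ℍ) : ℂ) with hd
  have hd0 : d ≠ 0 := deriv_coe_symm_ofComplex_ne_zero V κ hκ hκs UpperHalfPlane.I
  -- the generator realising `w`: `X₀₁ + (X₀₀ - X₁₁) i = w / d`
  let X : Matrix (Fin 2) (Fin 2) ℝ := !![(w / d).im / 2, (w / d).re; 0, -((w / d).im / 2)]
  have hX : X.trace = 0 := by
    show Matrix.trace !![(w / d).im / 2, (w / d).re; 0, -((w / d).im / 2)] = 0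
    rw [Matrix.trace_fin_two_of]; ring
  obtain ⟨φ, hφc, hφ⟩ := OneParameterSubgroupsPSL2R.exists_expHom X hX
  let f : Multiplicative ℝ →* holAut (⊤ : Opens V) :=
    F.toMonoidHom.comp ((QuotientGroup.mk' (Subgroup.center SL(2, ℝ))).comp φ)
  have hfval : ∀ t : ℝ, f (Multiplicative.ofAdd t) =
      F ((φ (Multiplicative.ofAdd t) : SL(2, ℝ)) : SL(2, ℝ) ⧸ Subgroup.center SL(2, ℝ)) := fun t => rfl
  refine ⟨f, ?_, ?_⟩
  · show Continuous (fun t => f t)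
    simp only [f, MonoidHom.coe_comp, comp_apply]
    exact F.continuous.comp ((QuotientGroup.continuous_mk).comp hφc)
  · -- the orbit is `G ((exp tX) · i)`
    have hfun : (fun t : ℝ => (((((f (Multiplicative.ofAdd t) : holAut (⊤ : Opens V)) :
        (⊤ : Opens V) ≃ₜ (⊤ : Opens V)) ⟨p, trivial⟩ : (⊤ : Opens V)) : V) : ℂ)) =
        fun t : ℝ => G (((φ (Multiplicative.ofAdd t) • UpperHalfPlane.I : ℍ) : ℂ)) := by
      funext t
      rw [hfval t, hF, Homeomorph.trans_apply, Homeomorph.trans_apply, Homeomorph.smul_apply, hκp, hG]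
      simp only [ofComplex_apply]
    rw [hfun]
    have hγ := OneParameterSubgroupsPSL2R.hasDerivAt_coe_expHom_smul X hX φ hφ UpperHalfPlane.I
    have h0 : ((φ (Multiplicative.ofAdd 0) • UpperHalfPlane.I : ℍ) : ℂ) = Complex.I := by
      rw [show Multiplicative.ofAdd (0 : ℝ) = 1 from rfl, map_one, one_smul, UpperHalfPlane.coe_I]
    have hG0 : DifferentiableAt ℂ G ((φ (Multiplicative.ofAdd 0) • UpperHalfPlane.I : ℍ) : ℂ) :=
      differentiableAt_coe_symm_ofComplex V κ hκs _
    have h := hasDerivAt_comp_real_curve (k := G) hG0.hasDerivAt hγ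
    rw [h0] at h
    refine h.congr_deriv ?_
    have h00 : X 0 0 = (w / d).im / 2 := rfl
    have h01 : X 0 1 = (w / d).re := rfl
    have h10 : X 1 0 = 0 := rfl
    have h11 : X 1 1 = -((w / d).im / 2) := rfl
    have hdI : deriv G Complex.I = d := by rw [hd, UpperHalfPlane.coe_I]
    rw [h00, h01, h10, h11, UpperHalfPlane.coe_I, hdI]
    have hw'eq : (((w / d).re : ℝ) : ℂ) + ((((w / d).im / 2 : ℝ) : ℂ) - ((-((w / d).im / 2) : ℝ) : ℂ)) * Complex.I -
        ((0 : ℝ) : ℂ) * Complex.I ^ 2 = w / d := by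
      conv_rhs => rw [← Complex.re_add_im (w / d)]
      push_cast
      ring
    rw [hw'eq, mul_div_cancel₀ _ hd0]


/-! ### Elements of order four in the stabiliser of `p` -/

/-- **The stabiliser of `p` in `Aut^hol(V)` contains an element of order four** ("an element of order
four [i.e., '`±i`'] of a compact one-parameter subgroup … that fixes `p`"): the image of the rotation
`R(π/4) ∈ SL₂(ℝ)` (of order four modulo `±1`) once `p` is moved to `i`.
[cite: MochizukiAbsTopIII2015, Corollary 2.7 (d) p.59] -/
theorem exists_orderFour_stabilizer (hV : IsAutHolDisc V) (p : V) :
    ∃ k : holAut (⊤ : Opens V),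
      ((k : holAut (⊤ : Opens V)) : (⊤ : Opens V) ≃ₜ (⊤ : Opens V)) ⟨p, trivial⟩ = ⟨p, trivial⟩ ∧
      k * k * k * k = 1 ∧ k * k ≠ 1 := by
  letI := homeoCompactOpen (⊤ : Opens V)
  obtain ⟨κ, hκ, hκs, hκp⟩ := exists_chart_upperHalfPlane_centered V hV p
  obtain ⟨F, hF⟩ := exists_continuousMulEquiv_sl κ hκ hκs (holAut (⊤ : Opens V)) fun ψ => mem_holAut_iff ψ
  -- the rotation `R(π/4)` and its square `R(π/2)`
  set c : ℝ := Real.sqrt 2 / 2 with hcdef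
  have hcc : c * c = 1 / 2 := by
    rw [hcdef]
    nlinarith [Real.mul_self_sqrt (show (0 : ℝ) ≤ 2 by norm_num)]
  have hc0 : c ≠ 0 := by
    intro h; rw [h, mul_zero] at hcc; norm_num at hcc
  let r : SL(2, ℝ) := ⟨!![c, -c; c, c], by rw [Matrix.det_fin_two_of]; linarith⟩
  let r2 : SL(2, ℝ) := ⟨!![0, -1; 1, 0], by simp [Matrix.det_fin_two_of]⟩
  have hr2 : r * r = r2 := by
    apply Subtype.ext
    ext i j
    fin_cases i <;> fin_cases j <;>
      simp [r, r2, Matrix.mul_apply, Fin.sum_univ_two] <;> linarith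
  have hr4 : r * r * r * r = -1 := by
    rw [show r * r * r * r = (r * r) * (r * r) from by simp only [mul_assoc], hr2]
    apply Subtype.ext
    ext i j
    fin_cases i <;> fin_cases j <;> simp [r2, Matrix.mul_apply, Fin.sum_univ_two]
  -- the rotation fixes `i`
  have hrI : r • UpperHalfPlane.I = UpperHalfPlane.I := by
    apply UpperHalfPlane.ext
    rw [coe_sl_smul, UpperHalfPlane.coe_I]
    have h00 : (r 0 0 : ℝ) = c := rfl
    have h01 : (r 0 1 : ℝ) = -c := rfl
    have h10 : (r 1 0 : ℝ) = c := rfl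
    have h11 : (r 1 1 : ℝ) = c := rfl
    rw [h00, h01, h10, h11]
    have hden : (c : ℂ) * Complex.I + (c : ℂ) ≠ 0 := by
      intro h
      have h' := congrArg Complex.re h
      simp at h'
      exact hc0 h'
    rw [div_eq_iff hden]
    push_cast
    ring_nf
    rw [Complex.I_sq]
    ring
  refine ⟨F (r : SL(2, ℝ) ⧸ Subgroup.center SL(2, ℝ)), ?_, ?_, ?_⟩
  · rw [hF r, Homeomorph.trans_apply, Homeomorph.trans_apply, Homeomorph.smul_apply, hκp, hrI, ← hκp,
      Homeomorph.symm_apply_apply]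
  · rw [← map_mul, ← map_mul, ← map_mul, ← QuotientGroup.mk_mul, ← QuotientGroup.mk_mul,
      ← QuotientGroup.mk_mul, hr4, (OneParameterSubgroupsPSL2R.mk_eq_one_iff (-1)).2 (Or.inr rfl), map_one]
  · intro h
    rw [← map_mul, ← QuotientGroup.mk_mul, hr2, ← map_one F] at h
    have h1 : ((r2 : SL(2, ℝ)) : SL(2, ℝ) ⧸ Subgroup.center SL(2, ℝ)) = 1 := F.injective h
    rw [OneParameterSubgroupsPSL2R.mk_eq_one_iff] at h1
    rcases h1 with h1 | h1
    · have h2 := congrArg (fun g : SL(2, ℝ) => (g : Matrix (Fin 2) (Fin 2) ℝ) 1 0) h1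
      simp [r2] at h2
    · have h2 := congrArg (fun g : SL(2, ℝ) => (g : Matrix (Fin 2) (Fin 2) ℝ) 1 0) h1
      simp [r2] at h2


/-! ### Conjugating by an order-four stabiliser element multiplies orbit velocities by `±i` -/

/-- Chain rule for a complex-differentiable map after a real curve, with the base point rewritten
(a re-packaging of abc-iut-w4-d104's `deriv_comp_real_curve` that avoids re-elaborating the maps).
[cite: MochizukiAbsTopIII2015, Corollary 2.7 (d) p.59] -/
theorem deriv_comp_real_curve_of_eq {K : ℂ → ℂ} {γ : ℝ → ℂ} {q : ℂ} (h0 : γ 0 = q)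
    (hK : DifferentiableAt ℂ K q) (hγ : DifferentiableAt ℝ γ 0) :
    deriv (fun s => K (γ s)) 0 = deriv K q * deriv γ 0 := by
  subst h0
  exact deriv_comp_real_curve hK hγ

/-- The planar pictures of `k` and `k⁻¹` (for `k ∈ Aut^hol(V)` fixing `p`) have derivatives at `p`
multiplying to `1`. [cite: MochizukiAbsTopIII2015, Corollary 2.7 (d) p.59] -/
theorem deriv_planar_inv_mul_deriv_planar (k : holAut (⊤ : Opens V)) (p : V)
    (hkp : ((k : holAut (⊤ : Opens V)) : (⊤ : Opens V) ≃ₜ (⊤ : Opens V)) ⟨p, trivial⟩ = ⟨p, trivial⟩) :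
    deriv (Function.extend Subtype.val (fun x : V => (((((k⁻¹ : holAut (⊤ : Opens V)) :
        (⊤ : Opens V) ≃ₜ (⊤ : Opens V)) ⟨x, trivial⟩ : (⊤ : Opens V)) : V) : ℂ)) (fun z => z)) p *
      deriv (Function.extend Subtype.val (fun x : V => (((((k : holAut (⊤ : Opens V)) :
        (⊤ : Opens V) ≃ₜ (⊤ : Opens V)) ⟨x, trivial⟩ : (⊤ : Opens V)) : V) : ℂ)) (fun z => z)) p = 1 := by
  obtain ⟨hK, hKd, -⟩ := planarPicture_holAut V k
  obtain ⟨-, hKid, -⟩ := planarPicture_holAut V k⁻¹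
  have hKl := planarPicture_holAut_inv V k
  have hKp : (Function.extend Subtype.val (fun x : V => (((((k : holAut (⊤ : Opens V)) : (⊤ : Opens V) ≃ₜ (⊤ : Opens V)) ⟨x, trivial⟩ : (⊤ : Opens V)) : V) : ℂ)) (fun z => z)) p = p := by rw [hK, hkp]
  have hKd' : DifferentiableAt ℂ (Function.extend Subtype.val (fun x : V => (((((k : holAut (⊤ : Opens V)) : (⊤ : Opens V) ≃ₜ (⊤ : Opens V)) ⟨x, trivial⟩ : (⊤ : Opens V)) : V) : ℂ)) (fun z => z)) p := hKd.differentiableAt (V.2.mem_nhds p.2)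
  have hKid' : DifferentiableAt ℂ (Function.extend Subtype.val (fun x : V => (((((k⁻¹ : holAut (⊤ : Opens V)) : (⊤ : Opens V) ≃ₜ (⊤ : Opens V)) ⟨x, trivial⟩ : (⊤ : Opens V)) : V) : ℂ)) (fun z => z)) ((Function.extend Subtype.val (fun x : V => (((((k : holAut (⊤ : Opens V)) : (⊤ : Opens V) ≃ₜ (⊤ : Opens V)) ⟨x, trivial⟩ : (⊤ : Opens V)) : V) : ℂ)) (fun z => z)) p) := by
    rw [hKp]; exact hKid.differentiableAt (V.2.mem_nhds p.2)
  have hcomp := hKid'.hasDerivAt.comp (p : ℂ) hKd'.hasDerivAt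
  have hev : id =ᶠ[𝓝 (p : ℂ)] ((Function.extend Subtype.val (fun x : V => (((((k⁻¹ : holAut (⊤ : Opens V)) : (⊤ : Opens V) ≃ₜ (⊤ : Opens V)) ⟨x, trivial⟩ : (⊤ : Opens V)) : V) : ℂ)) (fun z => z)) ∘ (Function.extend Subtype.val (fun x : V => (((((k : holAut (⊤ : Opens V)) : (⊤ : Opens V) ≃ₜ (⊤ : Opens V)) ⟨x, trivial⟩ : (⊤ : Opens V)) : V) : ℂ)) (fun z => z))) :=
    Filter.eventuallyEq_of_mem (V.2.mem_nhds p.2) fun z hz => by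
      simp only [comp_apply, id_eq]; exact (hKl z hz).symm
  have h1 := (hcomp.congr_of_eventuallyEq hev).unique (hasDerivAt_id (p : ℂ))
  rw [hKp] at h1
  exact h1


set_option maxHeartbeats 400000 in
/-- **Velocity of the conjugate orbit**: for a continuous one-parameter subgroup `f` of `Aut^hol(V)` and
`k ∈ Aut^hol(V)` of order four fixing `p`, the orbit of `p` under `k f(·) k⁻¹` has velocity `c · v`
where `v` is the velocity of `t ↦ f(t) · p` and `c = ±i` is the derivative at `p` of the planar picture
of `k`. [cite: MochizukiAbsTopIII2015, Corollary 2.7 (d) p.59] -/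
theorem deriv_conj_orbit_eq (hV : IsAutHolDisc V) (p : V)
    (f : Multiplicative ℝ →* holAut (⊤ : Opens V)) (k : holAut (⊤ : Opens V))
    (hkp : ((k : holAut (⊤ : Opens V)) : (⊤ : Opens V) ≃ₜ (⊤ : Opens V)) ⟨p, trivial⟩ = ⟨p, trivial⟩)
    (hk4 : k * k * k * k = 1) (hk2 : k * k ≠ 1) :
    letI := homeoCompactOpen (⊤ : Opens V)
    Continuous f →
      (deriv (Function.extend Subtype.val (fun x : V => (((((k : holAut (⊤ : Opens V)) :
          (⊤ : Opens V) ≃ₜ (⊤ : Opens V)) ⟨x, trivial⟩ : (⊤ : Opens V)) : V) : ℂ)) (fun z => z)) p = Complex.I ∨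
        deriv (Function.extend Subtype.val (fun x : V => (((((k : holAut (⊤ : Opens V)) :
          (⊤ : Opens V) ≃ₜ (⊤ : Opens V)) ⟨x, trivial⟩ : (⊤ : Opens V)) : V) : ℂ)) (fun z => z)) p = -Complex.I) ∧
      deriv (fun t : ℝ =>
          (((((k * f (Multiplicative.ofAdd t) * k⁻¹ : holAut (⊤ : Opens V)) :
            (⊤ : Opens V) ≃ₜ (⊤ : Opens V)) ⟨p, trivial⟩ : (⊤ : Opens V)) : V) : ℂ)) 0 =
        deriv (Function.extend Subtype.val (fun x : V => (((((k : holAut (⊤ : Opens V)) :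
          (⊤ : Opens V) ≃ₜ (⊤ : Opens V)) ⟨x, trivial⟩ : (⊤ : Opens V)) : V) : ℂ)) (fun z => z)) p *
          deriv (fun t : ℝ =>
            (((((f (Multiplicative.ofAdd t) : holAut (⊤ : Opens V)) : (⊤ : Opens V) ≃ₜ (⊤ : Opens V))
              ⟨p, trivial⟩ : (⊤ : Opens V)) : V) : ℂ)) 0 := by
  letI := homeoCompactOpen (⊤ : Opens V)
  intro hf
  obtain ⟨κ, A, ψ, -, -, -, -, -, hder⟩ := hasDerivAt_orbit_of_continuous V hV f p hf
  -- adapted from abc-iut-L4-t7's `inner_eq_zero_of_tangent_conj_oneParameterSubgroup` (same plumbing)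
  obtain ⟨e, e', he, hem, he', he'm, hl, hr, hep⟩ := exists_planarChart_centered V hV p
  obtain ⟨hK, hKd, hKm⟩ := planarPicture_holAut V k
  obtain ⟨hKi, hKid, hKim⟩ := planarPicture_holAut V k⁻¹
  have hKl := planarPicture_holAut_inv V k
  have hKr : ∀ z ∈ (V : Set ℂ), (Function.extend Subtype.val (fun x : V => (((((k : holAut (⊤ : Opens V)) : (⊤ : Opens V) ≃ₜ (⊤ : Opens V)) ⟨x, trivial⟩ : (⊤ : Opens V)) : V) : ℂ)) (fun z => z)) ((Function.extend Subtype.val (fun x : V => (((((k⁻¹ : holAut (⊤ : Opens V)) : (⊤ : Opens V) ≃ₜ (⊤ : Opens V)) ⟨x, trivial⟩ : (⊤ : Opens V)) : V) : ℂ)) (fun z => z)) z) = z := by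
    have h := planarPicture_holAut_inv V k⁻¹
    rw [inv_inv] at h
    exact h
  have hKp : (Function.extend Subtype.val (fun x : V => (((((k : holAut (⊤ : Opens V)) : (⊤ : Opens V) ≃ₜ (⊤ : Opens V)) ⟨x, trivial⟩ : (⊤ : Opens V)) : V) : ℂ)) (fun z => z)) p = p := by
    rw [hK, hkp]
  have hKinvp : (Function.extend Subtype.val (fun x : V => (((((k⁻¹ : holAut (⊤ : Opens V)) : (⊤ : Opens V) ≃ₜ (⊤ : Opens V)) ⟨x, trivial⟩ : (⊤ : Opens V)) : V) : ℂ)) (fun z => z)) p = p := by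
    have h := hKl p p.2
    rwa [hKp] at h
  have hKK : ∀ y : (⊤ : Opens V), (Function.extend Subtype.val (fun x : V => (((((k : holAut (⊤ : Opens V)) : (⊤ : Opens V) ≃ₜ (⊤ : Opens V)) ⟨x, trivial⟩ : (⊤ : Opens V)) : V) : ℂ)) (fun z => z)) (((y : (⊤ : Opens V)) : V) : ℂ) =
      ((((k : holAut (⊤ : Opens V)) : (⊤ : Opens V) ≃ₜ (⊤ : Opens V)) ⟨y, trivial⟩ : (⊤ : Opens V)) : V) := by
    intro y
    rw [hK]
  have hk4y : ∀ y : (⊤ : Opens V),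
      ((k : holAut (⊤ : Opens V)) : (⊤ : Opens V) ≃ₜ (⊤ : Opens V))
        (((k : holAut (⊤ : Opens V)) : (⊤ : Opens V) ≃ₜ (⊤ : Opens V))
          (((k : holAut (⊤ : Opens V)) : (⊤ : Opens V) ≃ₜ (⊤ : Opens V))
            (((k : holAut (⊤ : Opens V)) : (⊤ : Opens V) ≃ₜ (⊤ : Opens V)) y))) = y := by
    intro y
    have h := congrArg (fun g : holAut (⊤ : Opens V) => ((g : holAut (⊤ : Opens V)) :
      (⊤ : Opens V) ≃ₜ (⊤ : Opens V)) y) hk4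
    simpa [Homeomorph.mul_apply] using h
  have hK4 : EqOn ((Function.extend Subtype.val (fun x : V => (((((k : holAut (⊤ : Opens V)) : (⊤ : Opens V) ≃ₜ (⊤ : Opens V)) ⟨x, trivial⟩ : (⊤ : Opens V)) : V) : ℂ)) (fun z => z)) ∘ (Function.extend Subtype.val (fun x : V => (((((k : holAut (⊤ : Opens V)) : (⊤ : Opens V) ≃ₜ (⊤ : Opens V)) ⟨x, trivial⟩ : (⊤ : Opens V)) : V) : ℂ)) (fun z => z)) ∘ (Function.extend Subtype.val (fun x : V => (((((k : holAut (⊤ : Opens V)) : (⊤ : Opens V) ≃ₜ (⊤ : Opens V)) ⟨x, trivial⟩ : (⊤ : Opens V)) : V) : ℂ)) (fun z => z)) ∘ (Function.extend Subtype.val (fun x : V => (((((k : holAut (⊤ : Opens V)) : (⊤ : Opens V) ≃ₜ (⊤ : Opens V)) ⟨x, trivial⟩ : (⊤ : Opens V)) : V) : ℂ)) (fun z => z))) id V := by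
    intro z hz
    simp only [comp_apply, id_eq]
    have h0 : z = (((⟨⟨z, hz⟩, trivial⟩ : (⊤ : Opens V)) : V) : ℂ) := rfl
    rw [h0, hKK, hKK, hKK, hKK, hk4y]
  have hK2 : ¬ EqOn ((Function.extend Subtype.val (fun x : V => (((((k : holAut (⊤ : Opens V)) : (⊤ : Opens V) ≃ₜ (⊤ : Opens V)) ⟨x, trivial⟩ : (⊤ : Opens V)) : V) : ℂ)) (fun z => z)) ∘ (Function.extend Subtype.val (fun x : V => (((((k : holAut (⊤ : Opens V)) : (⊤ : Opens V) ≃ₜ (⊤ : Opens V)) ⟨x, trivial⟩ : (⊤ : Opens V)) : V) : ℂ)) (fun z => z))) id V := by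
    intro h
    apply hk2
    apply Subtype.ext
    ext y
    have h1 := h (y : V).2
    simp only [comp_apply, id_eq] at h1
    rw [hKK, hKK] at h1
    rw [Subgroup.coe_mul, Homeomorph.mul_apply, Subgroup.coe_one, Homeomorph.one_apply]
    exact congrArg Subtype.val (Subtype.ext h1)
  -- `K` has derivative `±i` at `p`
  have hc := stab_deriv_eq_I_or_of_order_four V.2 he hem he' he'm hl hr p.2 hep hKd hKm hKid hKim hKl hKr hKp
    hK4 hK2
  -- the conjugate orbit is `K ∘ (orbit of f)` since `k⁻¹` fixes `p`
  have hkpinv : ((k⁻¹ : holAut (⊤ : Opens V)) : (⊤ : Opens V) ≃ₜ (⊤ : Opens V)) ⟨p, trivial⟩ = ⟨p, trivial⟩ := by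
    have h := congrArg ((k⁻¹ : holAut (⊤ : Opens V)) : (⊤ : Opens V) ≃ₜ (⊤ : Opens V)) hkp
    rw [← Homeomorph.mul_apply, ← Subgroup.coe_mul, inv_mul_cancel, Subgroup.coe_one,
      Homeomorph.one_apply] at h
    exact h.symm
  have hconjorb : (fun t : ℝ => (((((k * f (Multiplicative.ofAdd t) * k⁻¹ : holAut (⊤ : Opens V)) : (⊤ : Opens V) ≃ₜ (⊤ : Opens V)) ⟨p, trivial⟩ : (⊤ : Opens V)) : V) : ℂ)) =
      fun t => (Function.extend Subtype.val (fun x : V => (((((k : holAut (⊤ : Opens V)) : (⊤ : Opens V) ≃ₜ (⊤ : Opens V)) ⟨x, trivial⟩ : (⊤ : Opens V)) : V) : ℂ)) (fun z => z)) ((fun t : ℝ => (((((f (Multiplicative.ofAdd t) : holAut (⊤ : Opens V)) : (⊤ : Opens V) ≃ₜ (⊤ : Opens V)) ⟨p, trivial⟩ : (⊤ : Opens V)) : V) : ℂ)) t) := by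
    funext t
    rw [Subgroup.coe_mul, Subgroup.coe_mul, Homeomorph.mul_apply, Homeomorph.mul_apply, hkpinv, hK]
  have horb0 : (fun t : ℝ => (((((f (Multiplicative.ofAdd t) : holAut (⊤ : Opens V)) : (⊤ : Opens V) ≃ₜ (⊤ : Opens V)) ⟨p, trivial⟩ : (⊤ : Opens V)) : V) : ℂ)) 0 = (p : ℂ) := by
    simp only [show Multiplicative.ofAdd (0 : ℝ) = 1 from rfl, map_one, Subgroup.coe_one, Homeomorph.one_apply]
  have hdiff : DifferentiableAt ℝ (fun t : ℝ => (((((f (Multiplicative.ofAdd t) : holAut (⊤ : Opens V)) : (⊤ : Opens V) ≃ₜ (⊤ : Opens V)) ⟨p, trivial⟩ : (⊤ : Opens V)) : V) : ℂ)) 0 := hder.differentiableAt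
  have hKdp : DifferentiableAt ℂ (Function.extend Subtype.val (fun x : V => (((((k : holAut (⊤ : Opens V)) : (⊤ : Opens V) ≃ₜ (⊤ : Opens V)) ⟨x, trivial⟩ : (⊤ : Opens V)) : V) : ℂ)) (fun z => z)) (p : ℂ) := hKd.differentiableAt (V.2.mem_nhds p.2)
  have hcomp := deriv_comp_real_curve_of_eq horb0 hKdp hdiff
  have h1 : deriv (fun t : ℝ => (((((k * f (Multiplicative.ofAdd t) * k⁻¹ : holAut (⊤ : Opens V)) :
      (⊤ : Opens V) ≃ₜ (⊤ : Opens V)) ⟨p, trivial⟩ : (⊤ : Opens V)) : V) : ℂ)) 0 =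
      deriv (fun t => (Function.extend Subtype.val (fun x : V => (((((k : holAut (⊤ : Opens V)) : (⊤ : Opens V) ≃ₜ (⊤ : Opens V)) ⟨x, trivial⟩ : (⊤ : Opens V)) : V) : ℂ)) (fun z => z)) ((fun t : ℝ => (((((f (Multiplicative.ofAdd t) : holAut (⊤ : Opens V)) : (⊤ : Opens V) ≃ₜ (⊤ : Opens V)) ⟨p, trivial⟩ : (⊤ : Opens V)) : V) : ℂ)) t)) 0 :=
    congrArg (fun F : ℝ → ℂ => deriv F 0) hconjorb
  exact ⟨hc, h1.trans hcomp⟩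

end Cor27e

end Literature.AnabelianGeometry.AbsoluteAnabelian

end
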